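import Summits.QuantumFields.GaugeBoot.ZdCentralTwist
import Summits.QuantumFields.GaugeBoot.ClassBDiagonalWordBlocks
import HarnessLib

/-!
# The `ℤ^d` staggered central twist versus reflections and axis permutations
# (gauge-boot, L3 structural supplement; `ℤ^d` twist 2/4)

HONEST FRAMING (cell `pub-gaugeboot`, page 1 of every file): the venture produces certified bounds
on lattice expectations at stated coupling, gauge group, dimension and torus size; NOT a mass gap,
NOT a continuum limit, NOT a string tension; NOT Yang–Mills-summit-bearing (barriers
`FixedCouplingUltralocality`, `PerturbativeInvisibility`). This module bounds no expectation; no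
certificate of the cell sits at `β < 0`. Pure algebra (no measures).

Part 1 (`ZdCentralTwist.lean`): the Kogut–Susskind twist `T = centralTwist (stagTwist π r z)` of
`ℤ^d` configurations (`z` central, `z² = 1`; parities `π_m(x) = x_m mod 2`, axis `r` last) versus
one-link Gibbs states and translations. Here: the twist versus the generators of the
hyperoctahedral group and the mirror maps of the three reflection-positivity families of the
lattice bootstrap (`ClassB.lean`: `configSiteReflect`, `configLinkReflect`, `configDiagSwapZd`,
`configPerm`).

* `quad_add_quad_shift`, ★ `centralTwist_quad_eq_gaugeTransformZd` — the algebraic heart: a twist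
  whose weight on the link `(x, m)` is `z^{∑_a D_{am} x_a + b_m}` with `D` SYMMETRIC and ZERO ON THE
  DIAGONAL is the gauge transformation by `g(x) = z^{∑_{a<c} D_{ac} x_a x_c + ∑_a b_a x_a}` (a flat
  `ℤ/2` connection on `ℤ^d` is pure gauge, made explicit); `ite_add_ite_symm_of_xor`,
  `ite_add_ite_diag_of_irrefl` (two strict total orders differ by such a `D`);
* `IsDualParity.stagParity_zd` / `_zdSiteReflect` / `_sub_single_self` / `_zdLinkReflect` / `_perm`
  — the staggered parity `c(x, k) = ∑_{m ≺ k} x_m` under the lattice symmetries;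
* ★ `configSiteReflect_centralTwist_stagTwist` — the twist COMMUTES with every site reflection
  `x_i ↦ -x_i` (parities are even); ★ `configLinkReflect_centralTwist_stagTwist` — with the link
  reflection `x_i ↦ 1 - x_i` up to the gauge transformation `x ↦ z^{∑_{i ≺ k} x_k}`, trivial for the
  last axis (`configLinkReflect_centralTwist_stagTwist_last`); ★ `configPerm_centralTwist_stagTwist`
  — with every axis permutation `σ` up to the quadratic gauge transformation of the pairs whose
  order `σ` reverses; ★ `configDiagSwapZd_centralTwist_stagTwist` (the diagonal mirror `x_i = x_j`
  is the transposition, `configDiagSwapZd_eq_configPerm` of `ClassBDiagonalWordBlocks.lean`);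
  `centralTwist_stagTwist_eq_gauge_of_last` (two choices of the last axis give gauge-equivalent
  twists).

Consequences for states (invariances, reflection positivity of twisted states, the twist of a
Class-B state): part 3 (`ZdCentralTwistStates.lean`). Structural; NOT a bound on any expectation.
[folklore] bookkeeping (Kogut–Susskind, Phys. Rev. D 11 (1975) 395; Li–Meurice, Phys. Rev. D 71
(2005) 016008 §II: no swap-symmetric staggering exists, but any two staggerings are gauge
equivalent on the simply connected lattice `ℤ^d`).
-/

noncomputable section

open Literature.Probability.LatticeModels (Site)
open Literature.MathematicalPhysics.QuantumLattice

namespace Summit.QuantumFields.GaugeBoot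

namespace TiltedRP

variable {d N : ℕ} {G : Type*} [Group G]

/-! ## A flat `ℤ/2` connection on `ℤ^d` is pure gauge (quadratic gauge functions) -/

section Quad

/-- The polarisation identity behind `centralTwist_quad_eq_gaugeTransformZd`: for `D` symmetric with
zero diagonal, `G(X) = ∑_{a<c} D_{ac} X_a X_c + ∑_a b_a X_a` satisfies
`G(X) + G(X + δ_m) = ∑_a D_{am} X_a + b_m` over `ℤ/2`. -/
theorem quad_add_quad_shift (D : Fin d → Fin d → ZMod 2) (hDs : ∀ a c, D a c = D c a)
    (hDd : ∀ a, D a a = 0) (b : Fin d → ZMod 2) (X : Fin d → ZMod 2) (m : Fin d) :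
    (∑ a, ∑ c, (if a < c then D a c else 0) * X a * X c + ∑ a, b a * X a) +
      (∑ a, ∑ c, (if a < c then D a c else 0) * (X + Pi.single m 1 : Fin d → ZMod 2) a *
          (X + Pi.single m 1 : Fin d → ZMod 2) c +
        ∑ a, b a * (X + Pi.single m 1 : Fin d → ZMod 2) a) = ∑ a, D a m * X a + b m := by
  have h2 : ∀ u v : ZMod 2, u + (u + v) = v := by decide
  set q : Fin d → Fin d → ZMod 2 := fun a c => if a < c then D a c else 0 with hq
  have hδ : ∀ a, (X + Pi.single m 1 : Fin d → ZMod 2) a = X a + if a = m then 1 else 0 := fun a => by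
    rw [Pi.add_apply, Pi.single_apply]
  simp_rw [hδ]
  have hquad : ∑ a, ∑ c, q a c * (X a + if a = m then 1 else 0) * (X c + if c = m then 1 else 0) =
      ∑ a, ∑ c, q a c * X a * X c + (∑ a, q a m * X a + ∑ c, q m c * X c) := by
    have hexp : ∀ a c, q a c * (X a + if a = m then 1 else 0) * (X c + if c = m then 1 else 0) =
        q a c * X a * X c + ((if c = m then q a c * X a else 0) + (if a = m then q a c * X c else 0) +
          (if a = m then if c = m then q a c else 0 else 0)) := by
      intro a c
      split_ifs <;> ring
    simp_rw [hexp, Finset.sum_add_distrib]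
    rw [add_assoc]
    congr 1
    have hA : ∑ a, ∑ c, (if c = m then q a c * X a else 0) = ∑ a, q a m * X a :=
      Finset.sum_congr rfl fun a _ => by
        rw [Finset.sum_ite_eq' Finset.univ m, if_pos (Finset.mem_univ m)]
    have hB : ∑ a, ∑ c, (if a = m then q a c * X c else 0) = ∑ c, q m c * X c := by
      rw [Finset.sum_comm]
      exact Finset.sum_congr rfl fun c _ => by
        rw [Finset.sum_ite_eq' Finset.univ m, if_pos (Finset.mem_univ m)]
    have hC : ∑ a, ∑ c, (if a = m then if c = m then q a c else 0 else 0) = 0 := by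
      rw [Finset.sum_eq_single m (fun a _ ha => by simp [ha]) (fun h => absurd (Finset.mem_univ m) h)]
      simp [hq]
    rw [hA, hB, hC, add_zero]
  have hlin : ∑ a, b a * (X a + if a = m then 1 else 0) = ∑ a, b a * X a + b m := by
    simp_rw [mul_add, Finset.sum_add_distrib, mul_ite, mul_one, mul_zero]
    rw [Finset.sum_ite_eq' Finset.univ m, if_pos (Finset.mem_univ m)]
  rw [hquad, hlin]
  have hsym : ∑ a, q a m * X a + ∑ c, q m c * X c = ∑ a, D a m * X a := by
    rw [← Finset.sum_add_distrib]
    refine Finset.sum_congr rfl fun a _ => ?_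
    rw [← add_mul]
    congr 1
    simp only [hq]
    rcases lt_trichotomy a m with h | rfl | h
    · rw [if_pos h, if_neg (not_lt.2 h.le), add_zero]
    · rw [if_neg (lt_irrefl _), add_zero, hDd]
    · rw [if_neg (not_lt.2 h.le), if_pos h, zero_add, hDs]
  rw [← hsym]
  set Q := ∑ a, ∑ c, q a c * X a * X c
  set L := ∑ a, b a * X a
  set S := ∑ a, q a m * X a + ∑ c, q m c * X c
  calc Q + L + (Q + S + (L + b m)) = Q + (Q + (L + (L + (S + b m)))) := by ring
    _ = S + b m := by rw [h2, h2]

variable {z : G}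

/-- ★ **A flat `ℤ/2` connection on `ℤ^d` is pure gauge.** A twist whose weight on the link `(x, m)`
is `z^{∑_a D_{am} x_a + b_m}` (`D : Fin d → Fin d → ℤ/2` symmetric with zero diagonal, `b` arbitrary;
`z` central, `z² = 1`) is the gauge transformation by `g(x) = z^{∑_{a<c} D_{ac} x_a x_c + ∑_a b_a x_a}`. -/
theorem centralTwist_quad_eq_gaugeTransformZd (hzc : ∀ g : G, z * g = g * z) (hz2 : z * z = 1)
    (D : Fin d → Fin d → ZMod 2) (hDs : ∀ a c, D a c = D c a) (hDd : ∀ a, D a a = 0)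
    (b : Fin d → ZMod 2) {t : ZdEdge d → G}
    (ht : ∀ x m, t (x, m) = zpow₂ z (∑ a, D a m * (x a : ZMod 2) + b m)) (U : LGConfig d G) :
    centralTwist t U = gaugeTransformZd (fun x : Site d => zpow₂ z
      (∑ a, ∑ c, (if a < c then D a c else 0) * (x a : ZMod 2) * (x c : ZMod 2) +
        ∑ a, b a * (x a : ZMod 2))) U := by
  have hzc' : ∀ (a : ZMod 2) (g : G), zpow₂ z a * g = g * zpow₂ z a := fun a g => by
    unfold zpow₂; split_ifs <;> simp [hzc]
  have hinv : ∀ a : ZMod 2, (zpow₂ z a)⁻¹ = zpow₂ z a := fun a => by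
    unfold zpow₂; split_ifs
    · exact inv_eq_of_mul_eq_one_right hz2
    · exact inv_one
  funext l
  obtain ⟨x, m⟩ := l
  rw [centralTwist_apply, ht x m]
  simp only [gaugeTransformZd]
  rw [hinv, mul_assoc, ← hzc', ← mul_assoc, ← zpow₂_add hz2]
  congr 2
  have hX : ∀ a, (((x + Pi.single m (1 : ℤ) : Site d) a : ℤ) : ZMod 2) =
      ((fun a => (x a : ZMod 2)) + Pi.single m 1 : Fin d → ZMod 2) a := by
    intro a
    rw [Pi.add_apply, Pi.add_apply, Int.cast_add, Pi.single_apply, Pi.single_apply]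
    split_ifs <;> simp
  simp_rw [hX]
  exact (quad_add_quad_shift D hDs hDd b (fun a => (x a : ZMod 2)) m).symm

/-- Symmetry of the `ℤ/2` matrix `[P a c] + [Q a c]` for two strict total orders `P`, `Q`
(trichotomous and irreflexive relations). -/
theorem ite_add_ite_symm_of_xor {P Q : Fin d → Fin d → Prop} [DecidableRel P] [DecidableRel Q]
    (hP : ∀ a c, a ≠ c → (P a c ↔ ¬P c a)) (hQ : ∀ a c, a ≠ c → (Q a c ↔ ¬Q c a)) (a c : Fin d) :
    ((if P a c then (1 : ZMod 2) else 0) + if Q a c then 1 else 0) =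
      ((if P c a then (1 : ZMod 2) else 0) + if Q c a then 1 else 0) := by
  by_cases hac : a = c
  · subst hac; rfl
  have hflip : ∀ (R S : Prop) [Decidable R] [Decidable S], (R ↔ ¬S) →
      ((if R then (1 : ZMod 2) else 0) = (if S then 1 else 0) + 1) := by
    intro R S _ _ h
    by_cases hS : S
    · rw [if_pos hS, if_neg (fun hR => (h.1 hR) hS)]; decide
    · rw [if_neg hS, if_pos (h.2 hS)]; decide
  have key : ∀ u v : ZMod 2, (u + 1) + (v + 1) = u + v := by decide
  rw [hflip _ _ (hP a c hac), hflip _ _ (hQ a c hac)]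
  exact key _ _

/-- Zero diagonal of the same matrix. -/
theorem ite_add_ite_diag_of_irrefl {P Q : Fin d → Fin d → Prop} [DecidableRel P] [DecidableRel Q]
    (hP : ∀ a, ¬P a a) (hQ : ∀ a, ¬Q a a) (a : Fin d) :
    ((if P a a then (1 : ZMod 2) else 0) + if Q a a then 1 else 0) = 0 := by
  rw [if_neg (hP a), if_neg (hQ a), add_zero]

/-- `≺` is irreflexive. -/
theorem precLast_irrefl (r a : Fin d) : ¬PrecLast r a a :=
  fun h => h.2.elim (fun h' => h.1 h') (lt_irrefl _)

end Quad

/-! ## The parity twist versus site / link reflections and axis permutations -/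

section Symmetries

variable {z : G} {π : Fin d → Site d →+ ZMod 2}

/-- The staggered parity on `ℤ^d` as a sum over all axes with an indicator:
`c(x, k) = ∑_m [m ≺ k] (x_m mod 2)`. -/
theorem IsDualParity.stagParity_zd (hπ : IsDualParity (zdUnit d) π) (r : Fin d) (x : Site d)
    (k : Fin d) :
    stagParity π r (x, k) = ∑ m, (if PrecLast r m k then 1 else 0) * (x m : ZMod 2) := by
  unfold stagParity
  rw [Finset.sum_filter]
  exact Finset.sum_congr rfl fun m _ => by rw [hπ.apply_zd]; split_ifs <;> simp

/-- **Site reflections preserve the staggered parities**: `c(θ_i x, k) = c(x, k)` for the site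
mirror `x_i ↦ -x_i` (`-x_i ≡ x_i (mod 2)`). -/
theorem IsDualParity.stagParity_zdSiteReflect (hπ : IsDualParity (zdUnit d) π) (r i : Fin d)
    (x : Site d) (k : Fin d) :
    stagParity π r (zdSiteReflect i x, k) = stagParity π r (x, k) := by
  rw [hπ.stagParity_zd, hπ.stagParity_zd]
  refine Finset.sum_congr rfl fun m _ => ?_
  by_cases hmi : m = i
  · subst hmi
    rw [zdSiteReflect, Function.update_self, Int.cast_neg, ZMod.neg_eq_self_mod_two]
  · rw [zdSiteReflect, Function.update_of_ne hmi]

/-- The parity of a link does not see its own coordinate: `c(y - e_i, i) = c(y, i)`. -/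
theorem IsDualParity.stagParity_sub_single_self (hπ : IsDualParity (zdUnit d) π) (r i : Fin d)
    (y : Site d) : stagParity π r (y - Pi.single i 1, i) = stagParity π r (y, i) := by
  rw [hπ.stagParity_zd, hπ.stagParity_zd]
  refine Finset.sum_congr rfl fun m _ => ?_
  by_cases hmi : m = i
  · subst hmi
    rw [if_neg (precLast_irrefl r m), zero_mul, zero_mul]
  · rw [Pi.sub_apply, Pi.single_eq_of_ne hmi, sub_zero]

/-- ★ **The parity twist commutes with every site reflection** `x_i ↦ -x_i`
(`configSiteReflect i`, direction-`i` links reversed): `Θ_i (T U) = T (Θ_i U)`. -/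
theorem configSiteReflect_centralTwist_stagTwist (hπ : IsDualParity (zdUnit d) π)
    (hzc : ∀ g : G, z * g = g * z) (hz2 : z * z = 1) (r i : Fin d) (U : LGConfig d G) :
    configSiteReflect i (centralTwist (stagTwist π r z) U) =
      centralTwist (stagTwist π r z) (configSiteReflect i U) := by
  have hzc' : ∀ (a : ZMod 2) (g : G), zpow₂ z a * g = g * zpow₂ z a := fun a g => by
    unfold zpow₂; split_ifs <;> simp [hzc]
  have hinv : ∀ a : ZMod 2, (zpow₂ z a)⁻¹ = zpow₂ z a := fun a => by
    unfold zpow₂; split_ifs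
    · exact inv_eq_of_mul_eq_one_right hz2
    · exact inv_one
  funext e
  obtain ⟨x, k⟩ := e
  by_cases hk : k = i
  · subst hk
    simp only [configSiteReflect, centralTwist_apply, ↓reduceIte, stagTwist, mul_inv_rev, hinv,
      hπ.stagParity_sub_single_self, hπ.stagParity_zdSiteReflect]
    rw [hzc']
  · simp only [configSiteReflect, centralTwist_apply, hk, ↓reduceIte, stagTwist,
      hπ.stagParity_zdSiteReflect]

/-- **Link reflections shift the staggered parities by a constant**:
`c(θ'_i x, k) = c(x, k) + [i ≺ k]` for the link mirror `x_i ↦ 1 - x_i`. -/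
theorem IsDualParity.stagParity_zdLinkReflect (hπ : IsDualParity (zdUnit d) π) (r i : Fin d)
    (x : Site d) (k : Fin d) :
    stagParity π r (zdLinkReflect i x, k) = stagParity π r (x, k) + if PrecLast r i k then 1 else 0 := by
  rw [hπ.stagParity_zd, hπ.stagParity_zd]
  have h : ∀ m, (if PrecLast r m k then (1 : ZMod 2) else 0) * ((zdLinkReflect i x m : ℤ) : ZMod 2) =
      (if PrecLast r m k then (1 : ZMod 2) else 0) * (x m : ZMod 2) +
        if m = i then (if PrecLast r m k then 1 else 0) else 0 := by
    intro m
    by_cases hmi : m = i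
    · subst hmi
      rw [if_pos rfl, zdLinkReflect, Function.update_self, Int.cast_sub, Int.cast_one]
      have h1 : ∀ c u : ZMod 2, c * (1 - u) = c * u + c := by decide
      exact h1 _ _
    · rw [if_neg hmi, zdLinkReflect, Function.update_of_ne hmi, add_zero]
  simp_rw [h]
  rw [Finset.sum_add_distrib, Finset.sum_ite_eq' Finset.univ i, if_pos (Finset.mem_univ i)]

/-- ★ **The parity twist commutes with the link reflection `x_i ↦ 1 - x_i` up to the gauge
transformation `x ↦ z^{∑_{i ≺ k} x_k}`** (a constant central flip of the links after `i` in the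
staggering order). -/
theorem configLinkReflect_centralTwist_stagTwist (hπ : IsDualParity (zdUnit d) π)
    (hzc : ∀ g : G, z * g = g * z) (hz2 : z * z = 1) (r i : Fin d) (U : LGConfig d G) :
    configLinkReflect i (centralTwist (stagTwist π r z) U) =
      gaugeTransformZd (fun x : Site d => zpow₂ z
          (∑ m, (if PrecLast r i m then 1 else 0) * (x m : ZMod 2)))
        (centralTwist (stagTwist π r z) (configLinkReflect i U)) := by
  have hzc' : ∀ (a : ZMod 2) (g : G), zpow₂ z a * g = g * zpow₂ z a := fun a g => by
    unfold zpow₂; split_ifs <;> simp [hzc]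
  have hinv : ∀ a : ZMod 2, (zpow₂ z a)⁻¹ = zpow₂ z a := fun a => by
    unfold zpow₂; split_ifs
    · exact inv_eq_of_mul_eq_one_right hz2
    · exact inv_one
  rw [← centralTwist_const_eq_gaugeTransformZd hzc hz2 (fun m => if PrecLast r i m then 1 else 0)
    (t := fun l => zpow₂ z (if PrecLast r i l.2 then 1 else 0)) (fun _ => rfl)]
  funext e
  obtain ⟨x, k⟩ := e
  by_cases hk : k = i
  · subst hk
    simp only [configLinkReflect, centralTwist_apply, ↓reduceIte, stagTwist, mul_inv_rev, hinv,
      hπ.stagParity_sub_single_self, hπ.stagParity_zdLinkReflect, if_neg (precLast_irrefl r k),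
      add_zero]
    rw [hzc' (stagParity π r (x, k))]
    unfold zpow₂
    simp
  · simp only [configLinkReflect, centralTwist_apply, hk, ↓reduceIte, stagTwist,
      hπ.stagParity_zdLinkReflect, zpow₂_add hz2]
    rw [hzc' (stagParity π r (x, k)) (zpow₂ z _), mul_assoc]

/-- For the LAST axis `r` of the staggering order the link reflection commutes with the twist
exactly (no axis follows `r`). -/
theorem configLinkReflect_centralTwist_stagTwist_last (hπ : IsDualParity (zdUnit d) π)
    (hzc : ∀ g : G, z * g = g * z) (hz2 : z * z = 1) (r : Fin d) (U : LGConfig d G) :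
    configLinkReflect r (centralTwist (stagTwist π r z) U) =
      centralTwist (stagTwist π r z) (configLinkReflect r U) := by
  rw [configLinkReflect_centralTwist_stagTwist hπ hzc hz2 r r U]
  have h0 : ∀ m : Fin d, ¬PrecLast r r m := fun m h => h.1 rfl
  funext e
  simp only [gaugeTransformZd, h0, if_false, zero_mul, Finset.sum_const_zero]
  unfold zpow₂
  simp

/-- **Axis permutations conjugate the staggering order**: for `σ ∈ S_d`,
`c(x ∘ σ, σ⁻¹ k) = ∑_a [σ⁻¹ a ≺ σ⁻¹ k] x_a`. -/
theorem IsDualParity.stagParity_perm (hπ : IsDualParity (zdUnit d) π) (r : Fin d)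
    (σ : Equiv.Perm (Fin d)) (x : Site d) (k : Fin d) :
    stagParity π r ((x ∘ σ : Site d), σ.symm k) =
      ∑ a, (if PrecLast r (σ.symm a) (σ.symm k) then 1 else 0) * (x a : ZMod 2) := by
  rw [hπ.stagParity_zd, ← Equiv.sum_comp σ (fun a =>
    (if PrecLast r (σ.symm a) (σ.symm k) then (1 : ZMod 2) else 0) * (x a : ZMod 2))]
  simp only [Function.comp_apply, Equiv.symm_apply_apply]

/-- ★ **The parity twist commutes with every axis permutation up to a quadratic `ℤ/2` gauge
transformation** (`configPerm σ`: `(x, k) ↦ (x ∘ σ, σ⁻¹ k)`): the two staggerings `s` and `s ∘ σ̂`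
are both flat with value `z`, so their ratio is pure gauge, with gauge function
`x ↦ z^{∑_{a<c} D_{ac} x_a x_c}`, `D_{ac} = [σ⁻¹a ≺ σ⁻¹c] + [a ≺ c]` (the pairs whose order `σ` reverses). -/
theorem configPerm_centralTwist_stagTwist (hπ : IsDualParity (zdUnit d) π)
    (hzc : ∀ g : G, z * g = g * z) (hz2 : z * z = 1) (r : Fin d) (σ : Equiv.Perm (Fin d))
    (U : LGConfig d G) :
    configPerm σ (centralTwist (stagTwist π r z) U) =
      gaugeTransformZd (fun x : Site d => zpow₂ z
          (∑ a, ∑ c, (if a < c then ((if PrecLast r (σ.symm a) (σ.symm c) then (1 : ZMod 2) else 0) +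
              if PrecLast r a c then 1 else 0) else 0) * (x a : ZMod 2) * (x c : ZMod 2) +
            ∑ a, (0 : ZMod 2) * (x a : ZMod 2)))
        (centralTwist (stagTwist π r z) (configPerm σ U)) := by
  rw [← centralTwist_quad_eq_gaugeTransformZd hzc hz2
    (fun a c => (if PrecLast r (σ.symm a) (σ.symm c) then (1 : ZMod 2) else 0) +
      if PrecLast r a c then 1 else 0)
    (ite_add_ite_symm_of_xor (P := fun a c => PrecLast r (σ.symm a) (σ.symm c)) (Q := PrecLast r)
      (fun a c hac => precLast_xor (σ.symm.injective.ne hac)) (fun a c hac => precLast_xor hac))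
    (ite_add_ite_diag_of_irrefl (P := fun a c => PrecLast r (σ.symm a) (σ.symm c)) (Q := PrecLast r)
      (fun a => precLast_irrefl r _) (precLast_irrefl r))
    (fun _ => 0)
    (t := fun l => zpow₂ z (∑ a, ((if PrecLast r (σ.symm a) (σ.symm l.2) then (1 : ZMod 2) else 0) +
      if PrecLast r a l.2 then 1 else 0) * (l.1 a : ZMod 2) + 0)) (fun _ _ => rfl)]
  funext e
  obtain ⟨x, k⟩ := e
  simp only [configPerm, centralTwist_apply, stagTwist]
  rw [← mul_assoc, ← zpow₂_add hz2]
  congr 2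
  rw [add_zero, hπ.stagParity_perm r σ x k, hπ.stagParity_zd r x k, ← Finset.sum_add_distrib]
  refine Finset.sum_congr rfl fun a _ => ?_
  have h3 : ∀ u v w : ZMod 2, u * w = (u + v) * w + v * w := by decide
  exact h3 _ _ _

/-- ★ **The parity twist commutes with the diagonal mirror `x_i = x_j` up to a gauge transformation.** -/
theorem configDiagSwapZd_centralTwist_stagTwist (hπ : IsDualParity (zdUnit d) π)
    (hzc : ∀ g : G, z * g = g * z) (hz2 : z * z = 1) (r i j : Fin d) :
    ∃ k : Site d → G, ∀ U : LGConfig d G,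
      configDiagSwapZd i j (centralTwist (stagTwist π r z) U) =
        gaugeTransformZd k (centralTwist (stagTwist π r z) (configDiagSwapZd i j U)) := by
  obtain ⟨k, hk⟩ : ∃ k : Site d → G, ∀ U : LGConfig d G,
      configPerm (Equiv.swap i j) (centralTwist (stagTwist π r z) U) =
        gaugeTransformZd k (centralTwist (stagTwist π r z) (configPerm (Equiv.swap i j) U)) :=
    ⟨_, configPerm_centralTwist_stagTwist hπ hzc hz2 r (Equiv.swap i j)⟩
  exact ⟨k, fun U => by rw [configDiagSwapZd_eq_configPerm]; exact hk U⟩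

/-- **Two choices of the last axis give gauge-equivalent twists**:
`T_{r'} U = (T_r U)^{g}` with `g(x) = z^{∑_{a<c} D_{ac} x_a x_c}`, `D_{ac} = [a ≺_{r'} c] + [a ≺_r c]`. -/
theorem centralTwist_stagTwist_eq_gauge_of_last (hπ : IsDualParity (zdUnit d) π)
    (hzc : ∀ g : G, z * g = g * z) (hz2 : z * z = 1) (r r' : Fin d) :
    ∃ k : Site d → G, ∀ U : LGConfig d G,
      centralTwist (stagTwist π r' z) U = gaugeTransformZd k (centralTwist (stagTwist π r z) U) := by
  have key : ∀ U : LGConfig d G, centralTwist (fun l : ZdEdge d => zpow₂ z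
      (∑ a, ((if PrecLast r' a l.2 then (1 : ZMod 2) else 0) + if PrecLast r a l.2 then 1 else 0) *
        (l.1 a : ZMod 2) + 0)) (centralTwist (stagTwist π r z) U) = centralTwist (stagTwist π r' z) U := by
    intro U
    funext e
    obtain ⟨x, k⟩ := e
    simp only [centralTwist_apply, stagTwist]
    rw [← mul_assoc, ← zpow₂_add hz2]
    congr 2
    rw [add_zero, hπ.stagParity_zd r' x k, hπ.stagParity_zd r x k, ← Finset.sum_add_distrib]
    refine Finset.sum_congr rfl fun a _ => ?_
    have h3 : ∀ u v w : ZMod 2, (u + v) * w + v * w = u * w := by decide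
    exact h3 _ _ _
  refine ⟨fun x : Site d => zpow₂ z
      (∑ a, ∑ c, (if a < c then ((if PrecLast r' a c then (1 : ZMod 2) else 0) +
          if PrecLast r a c then 1 else 0) else 0) * (x a : ZMod 2) * (x c : ZMod 2) +
        ∑ a, (0 : ZMod 2) * (x a : ZMod 2)), fun U => ?_⟩
  rw [← key U]
  exact centralTwist_quad_eq_gaugeTransformZd hzc hz2
    (fun a c => (if PrecLast r' a c then (1 : ZMod 2) else 0) + if PrecLast r a c then 1 else 0)
    (ite_add_ite_symm_of_xor (P := PrecLast r') (Q := PrecLast r)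
      (fun a c hac => precLast_xor hac) (fun a c hac => precLast_xor hac))
    (ite_add_ite_diag_of_irrefl (P := PrecLast r') (Q := PrecLast r)
      (precLast_irrefl r') (precLast_irrefl r))
    (fun _ => 0) (fun _ _ => rfl) _

end Symmetries

end TiltedRP

end Summit.QuantumFields.GaugeBoot
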